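import Literature.AnabelianGeometry.EtaleTheta.Discharge.Sec4BaseRootLawAtKummerTateTower

/-!
# [SemiAnbd] Def. 3.1 (i) for the Galois group of the Kummer–Tate tower: `ℤ_γ × ℤ^ℕ` IS a tempered group; hence the
# `IG := «Galois»` forms of A10 / condition (d) at the tower with E2 (a) AND temperedness discharged

S. Mochizuki, *Semi-graphs of anabelioids*, Publ. RIMS **42** (2006) [MochizukiSemiAnbd2006], §3 Def. 3.1 (i) p.33 («may be
written as an inverse limit of an inverse system of surjections of countable discrete topological groups»); S. Mochizuki,
*The étale theta function …* [MochizukiEtTh2009], §4 Def. 4.1 (i)–(ii) p.86, Prop. 4.2 (iii) p.89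
[cite: MochizukiSemiAnbd2006, Def 3.1 (i) p.33].

abc-iut cell, W6 seat d058 lineage (gen 3); sequel to `LogDivisorModelTateTowerKummer{,RootLaw}.lean` and
`Discharge/Sec4BaseRootLawAtKummerTateTower.lean`.  ONE def (the open normal subgroups `Δ_n` packaged) + theorems:
* `TateTowerKummer.closureOpenNormal n : OpenNormalSubgroup Grp` (the `Δ_n` are open);
* **`TateTowerKummer.isTempered : IsTempered Grp`** — (a) the `Δ_n` (open, normal, countable index) form a basis of
  neighbourhoods of `1`; (b) they separate points; (c) completeness: a compatible family of cosets over all open normal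
  subgroups is read off on the `Δ_n` (`Grp/Δ_n ≅ ℤ × ℤ^n`) and glued coordinatewise (`Grp = lim ℤ × ℤ^n`);
* **`TateTowerKummer.baseRootLaw_galois_of_full_essSurj`** / **`condD_mkOfModelCanonical_galois_of_full_essSurj`** —
  abc-iut-L2-t3's `IG := «Galois»` forms (`baseRootLaw_galois_of_rootLaw_of_full_essSurj`,
  `condD_mkOfModelCanonical_galois_of_rootLaw_of_full_essSurj` = `…_ofTower_of_rootLaw`) at `T := tower` with BOTH
  `hG := isTempered` and `hR := rootLaw` DISCHARGED.
HONEST FRAMING: a combinatorial consistency witness; the existence of a tempered Frobenioid with full essentially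
surjective base over this tower is not claimed; nothing here bears on [IUTchIII] Cor. 3.12; no side taken; typed ≠ proved.
-/

noncomputable section

namespace Literature.AnabelianGeometry.EtaleTheta

open CategoryTheory Opposite Function Topology Literature.AlgebraicGeometry.Frobenioids
  Literature.AlgebraicGeometry.Frobenioids.QuasiTemperoid Literature.AnabelianGeometry.SemiGraphs LogDivisorTower

namespace TateTowerKummer

universe u₀ v₀

/-! ## `Δ_n` as open normal subgroups -/

/-- `Δ_n = {γ = 1} ∩ K_n` as an OPEN normal subgroup of `Grp` (the translation factor is discrete, `K_n` is open;
countable index: `countable_quotient`). [cite: MochizukiSemiAnbd2006, Def 3.1 (i) p.33] -/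
def closureOpenNormal (n : ℕ) : OpenNormalSubgroup Grp :=
  { toOpenSubgroup := ⟨closure n, by
      have h : (closure n : Set Grp) = (fun g : Grp => g.1) ⁻¹' {1} ∩ (kummerLevel n : Set Grp) :=
        Set.ext fun _ => Iff.rfl
      change IsOpen (closure n : Set Grp)
      rw [h]
      exact ((isOpen_discrete _).preimage continuous_fst).inter (isOpen_kummerLevel n)⟩ }

/-- Underlying subgroup of `closureOpenNormal n`. [cite: MochizukiSemiAnbd2006, Def 3.1 (i) p.33] -/
theorem closureOpenNormal_toSubgroup (n : ℕ) : (closureOpenNormal n).toSubgroup = closure n := rfl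

/-- Membership in `closureOpenNormal n`. [cite: MochizukiSemiAnbd2006, Def 3.1 (i) p.33] -/
theorem mem_closureOpenNormal_iff (n : ℕ) (g : Grp) : g ∈ closureOpenNormal n ↔ g ∈ closure n := Iff.rfl

/-- Every open normal subgroup contains some `Δ_n`. [cite: MochizukiSemiAnbd2006, Def 3.1 (i) p.33] -/
theorem exists_closureOpenNormal_le (N : OpenNormalSubgroup Grp) : ∃ n, closureOpenNormal n ≤ N := by
  obtain ⟨n, hn⟩ := exists_closure_subset_of_isOpen N.toOpenSubgroup.isOpen N.toOpenSubgroup.one_mem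
  exact ⟨n, fun g hg => hn hg⟩

/-! ## `Grp` is tempered -/

/-- **[SemiAnbd] Def. 3.1 (i): `ℤ_γ × ℤ^ℕ` is a TEMPERED group** — basis of open normal subgroups of countable index,
separation, and completeness (`Grp = lim_n ℤ × ℤ^n`). [cite: MochizukiSemiAnbd2006, Def 3.1 (i) p.33] -/
theorem isTempered : IsTempered Grp where
  basis U hU := by
    obtain ⟨V, hVU, hVo, h1V⟩ := mem_nhds_iff.mp hU
    obtain ⟨n, hn⟩ := exists_closure_subset_of_isOpen hVo h1V
    exact ⟨closureOpenNormal n, countable_quotient (le_refl (closure n)), hn.trans hVU⟩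
  separated g hg := by
    by_cases h1 : g.1 = 1
    · have h2 : g.2 ≠ 1 := fun h2 => hg (Prod.ext h1 h2)
      obtain ⟨i, hi⟩ := Function.ne_iff.1 h2
      exact ⟨closureOpenNormal (i + 1), fun hmem => hi (hmem.2 i (Nat.lt_succ_self i))⟩
    · exact ⟨closureOpenNormal 0, fun hmem => h1 hmem.1⟩
  complete x hx := by
    -- representatives modulo each `Δ_n`
    have hr : ∀ n, ∃ r : Grp, (r : Grp ⧸ (closureOpenNormal n).toSubgroup) = x (closureOpenNormal n) :=
      fun n => QuotientGroup.mk_surjective _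
    choose r hr using hr
    -- glue: translation from level 0, Kummer coordinate `i` from level `i + 1`
    refine ⟨((r 0).1, fun i => (r (i + 1)).2 i), fun N => ?_⟩
    -- two representatives of compatible levels agree modulo the coarser `Δ`
    have hcompat : ∀ {n m : ℕ}, m ≤ n → (r m)⁻¹ * r n ∈ closure m := by
      intro n m hmn
      have h1 : x (closureOpenNormal m) = (r n : Grp ⧸ (closureOpenNormal m).toSubgroup) :=
        hx (closureOpenNormal n) (closureOpenNormal m) (fun g hg => closure_antitone hmn hg) (r n) (hr n).symm
      rw [← hr m] at h1
      exact QuotientGroup.eq.1 h1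
    -- the glued element represents `x` modulo every `Δ_n`
    have hglue : ∀ n, x (closureOpenNormal n) = (((r 0).1, fun i => (r (i + 1)).2 i) : Grp) := by
      intro n
      rw [← hr n]
      refine QuotientGroup.eq.2 ⟨?_, fun i hi => ?_⟩
      · have h0 := (hcompat (Nat.zero_le n)).1
        rw [Prod.fst_mul, Prod.fst_inv, inv_mul_eq_one] at h0
        rw [Prod.fst_mul, Prod.fst_inv, ← h0, inv_mul_cancel]
      · have h2 := (hcompat (Nat.succ_le_of_lt hi)).2 i (Nat.lt_succ_self i)
        rw [Prod.snd_mul, Prod.snd_inv, Pi.mul_apply, Pi.inv_apply, inv_mul_eq_one] at h2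
        rw [Prod.snd_mul, Prod.snd_inv, Pi.mul_apply, Pi.inv_apply, ← h2, inv_mul_cancel]
    -- and hence modulo every open normal subgroup
    obtain ⟨n, hn⟩ := exists_closureOpenNormal_le N
    exact hx (closureOpenNormal n) N hn _ (hglue n)

/-! ## The `IG := «Galois»` forms of A10 and condition (d) at the tower, `hG` and `hR` discharged -/

variable {D : Type u₀} [Category.{v₀} D] {VD : FrdICatStub.{u₀, v₀, 0} D}
  (tf : TemperedFrobenioid (RealifiedDivisorMonoids.ofRlfZWeak (DivisorMonoids.ofTower tower) hpf) D VD)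
  [tf.base.Full] [tf.base.EssSurj]

/-- **A10 `BaseRootLaw «Galois»` at the Kummer–Tate tower, with E2 (a) AND temperedness discharged** (abc-iut-L2-t3's
`baseRootLaw_galois_of_rootLaw_of_full_essSurj` with `hG := isTempered`, `hR := rootLaw`).
[cite: MochizukiEtTh2009, Prop 4.2 (iii) p.89] -/
theorem baseRootLaw_galois_of_full_essSurj : tf.BaseRootLaw fun X => IsGaloisObj (tf.base.obj X).obj :=
  tf.baseRootLaw_galois_of_rootLaw_of_full_essSurj isTempered rootLaw

variable {K : Type 1} [Field K] (X : SemiGraphs.TemperedArithmeticGroup.{1} K)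
  (hP : ∀ A : Dᵒᵖ, IsPerfect (tf.Φ.carrier A))

/-- **Condition (d) of the canonical §4 model with `IG := «Galois»` at the Kummer–Tate tower, `hG` and `hR` discharged**
(abc-iut-L2-t3's `condD_mkOfModelCanonical_ofTower_of_rootLaw` at `T := tower`). [cite: MochizukiEtTh2009, Def 4.1 (i) p.86] -/
theorem condD_mkOfModelCanonical_galois_of_full_essSurj
    (gS : ∀ A : D, SemiGraphs.IsGaloisObj (tf.base.obj A).obj → (X.Pi →* Aut A))
    (gSs : ∀ (A : D) (h : SemiGraphs.IsGaloisObj (tf.base.obj A).obj), Function.Surjective (gS A h))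
    (NH : Subgroup (Field.absoluteGaloisGroup K) → tf.category → ℕ+ → Prop) (A₀ : tf.category)
    (hA₀ : PreFrobenioid.IsFrobeniusTrivial tf.toElem A₀) (hA₀' : SemiGraphs.IsGaloisObj (tf.base.obj A₀.base).obj)
    (hΦd : Objectwise (fun M _ => IsDivisorial M) tf.divisorMonoid)
    (hTF : ∀ (A : D) (N : ℕ), 0 < N →
      Function.Injective fun x : Algebra.GrothendieckGroup
        ((RealifiedDivisorMonoids.ofRlfZWeak (DivisorMonoids.ofTower tower) hpf).ΦR.obj (op (tf.base.obj A))) => x ^ N)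
    (A : (BiKummerSetting.mkOfModelCanonical X tf rfl hP (fun A => SemiGraphs.IsGaloisObj (tf.base.obj A).obj)
      gS gSs NH A₀ hA₀ hA₀').C)
    (hA : SemiGraphs.IsGaloisObj (tf.base.obj A.base).obj)
    (f : (BiKummerSetting.mkOfModelCanonical X tf rfl hP (fun A => SemiGraphs.IsGaloisObj (tf.base.obj A).obj)
      gS gSs NH A₀ hA₀ hA₀').biratUnits A) :
    BiKummerSetting.FractionPair.CondD (f := f) (fun {_} φ x => tf.pullFracModel φ x) :=
  BiKummerSetting.Prop42Sub.condD_mkOfModelCanonical_ofTower_of_rootLaw X tower tf hP isTempered gS gSs NH A₀ hA₀ hA₀'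
    hΦd hTF rootLaw A hA f

end TateTowerKummer

end Literature.AnabelianGeometry.EtaleTheta

end
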